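import Literature.AnabelianGeometry.AbsoluteAnabelian.AbsTopIII.KummerFaithfulSubpadicHolds
import Literature.AnabelianGeometry.AbsoluteAnabelian.AbsTopIII.KummerFaithfulFGExtensionProofs
import HarnessLib

/-!
# [AbsTopIII] Rmk. 1.5.4 (ii) in full: finitely generated extensions of Kummer-faithful fields are Kummer-faithful

Proof-only companion (no new definitions) to `AbsTopIII/KummerFaithful.lean` (S. Mochizuki, *Topics in
Absolute Anabelian Geometry III*, §1, Rmk. 1.5.4 (ii) p. 34, lit key `paper:url-5493eb38cbb7`): "every
finitely generated extension of a Kummer-faithful field (respectively, torally Kummer-faithful field) is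
itself Kummer-faithful (respectively, torally Kummer-faithful). Indeed, [...] one reduces immediately
to the case of extensions of finite type [...]; but then the affine [...] variety determined by [the
extension] has a dense subset of closed points, and by restricting to these closed points one reduces
to the original field."  The tree's named fact `Rmk_1_5_4_ii` records only the TORUS clause
("respectively"), PROVED in `KummerFaithfulFGExtensionProofs` (`Rmk_1_5_4_ii_holds`); its docstring
carries `-- TODO(general form): the same for "Kummer-faithful"`.  This file proves that general form
for the tree's `IsKummerFaithful` (tori and abelian varieties):

* `IsKummerFaithful.of_fg` — if `k` is Kummer-faithful and `L ⊇ k` is finitely generated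
  (`(⊤ : IntermediateField k L).FG`), then `L` is Kummer-faithful.

The abelian-variety clause is the printed "restricting to the closed points" made kernel-shaped by the
route that closed FACT-LIST row F-0369 (Rmk. 1.5.4 (i)) in the cell abc-iut, now run over an ARBITRARY
Kummer-faithful ground field instead of `ℚ_p`: induction on the transcendence degree through curves
(`essFiniteType_curve_induction`, `KummerFaithfulTrdegInductionProofs`), whose step — "Def. 1.5 (a) for
abelian varieties over all FINITE extensions of `F` ⇒ the same over all finite extensions of `F(X)`",
via spreading out to an abelian scheme over the Dedekind ring of a curve, Néron sections, Zariski's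
connectedness theorem for the special fibres and the finitely generated residue fields — is
`divisibleElementsTrivial_points_of_finite_ratFunc_of_residueFields`
(`KummerFaithfulDedekindInductionStepProofs`, characteristic zero), and whose base case is the
hypothesis on `k` itself.  Universe `0` (the step file is mono-universe).  Nothing here bears on
[IUTchIII] Cor. 3.12; typed ≠ discharged for anything but this remark.
-/

noncomputable section

open scoped Classical Polynomial

namespace Literature.AnabelianGeometry.AbsoluteAnabelian.AbsTopIII

open Literature.AlgebraicGeometry.Motives

/-- **Def. 1.5 (a) for abelian varieties ascends finitely generated extensions** ([AbsTopIII]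
Rmk. 1.5.4 (ii) p. 34, abelian-variety clause, "by restricting to these closed points one reduces to
the original field"): if `k` has characteristic zero and every abelian variety over every FINITE
extension of `k` satisfies `⋂_N N·A = 0` on rational points, then so does every abelian variety over
every finitely generated extension `L` of `k` — induction on the transcendence degree through curves
(`essFiniteType_curve_induction`) with the Dedekind/Néron/Zariski step
`divisibleElementsTrivial_points_of_finite_ratFunc_of_residueFields`.
[cite: MochizukiAbsTopIII2015, Rmk 1.5.4 (ii) p.34] -/
theorem divisibleElementsTrivial_points_of_essFiniteType {k : Type} [Field k] [CharZero k]
    (hk : ∀ (E : Type) [Field E] [Algebra k E], Module.Finite k E →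
      ∀ B : AbelianVariety E, DivisibleElementsTrivial (B.Points E))
    (L : Type) [Field L] [Algebra k L] [Algebra.EssFiniteType k L] (A : AbelianVariety L) :
    DivisibleElementsTrivial (A.Points L) := by
  refine essFiniteType_curve_induction (K₀ := k)
    (fun E _ _ => ∀ B : AbelianVariety E, DivisibleElementsTrivial (B.Points E)) ?_ ?_ L A
  · intro E _ _ _ B
    exact hk E inferInstance B
  · intro L₀ _ _ _ ih L' _ _ _ _ _ _ _ _ _ _ _ B
    haveI : CharZero L₀ := charZero_of_injective_algebraMap (algebraMap k L₀).injective
    refine divisibleElementsTrivial_points_of_finite_ratFunc_of_residueFields L₀ L'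
      (fun κ _ _ hfin => ?_) B
    letI : Algebra k κ := ((algebraMap L₀ κ).comp (algebraMap k L₀)).toAlgebra
    haveI : IsScalarTower k L₀ κ := IsScalarTower.of_algebraMap_eq fun _ => rfl
    haveI : FiniteDimensional L₀ κ := hfin
    exact ih κ

/-- **[AbsTopIII] Rmk. 1.5.4 (ii), in full: every finitely generated extension of a Kummer-faithful
field is Kummer-faithful** (for the tree's `IsKummerFaithful`: the torus clause is the named fact
`Rmk_1_5_4_ii`, PROVED as `Rmk_1_5_4_ii_holds`; the abelian-variety clause is
`divisibleElementsTrivial_points_of_essFiniteType` applied to the finitely generated extension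
`L' ⊇ L ⊇ k`, `L'` finite over `L`).  This is the `-- TODO(general form)` of `Rmk_1_5_4_ii` in
`KummerFaithful.lean`, at universe `0`. [cite: MochizukiAbsTopIII2015, Rmk 1.5.4 (ii) p.34] -/
theorem IsKummerFaithful.of_fg {k L : Type} [Field k] [Field L] [Algebra k L]
    (hFG : (⊤ : IntermediateField k L).FG) (hk : IsKummerFaithful k) : IsKummerFaithful L := by
  haveI : CharZero k := hk.torally.charZero
  refine ⟨Rmk_1_5_4_ii_holds k L hFG hk.torally, fun L' _ _ hfin A => ?_⟩
  haveI := hfin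
  -- `L'` as a finitely generated extension of `k`
  letI : Algebra k L' := ((algebraMap L L').comp (algebraMap k L)).toAlgebra
  haveI : IsScalarTower k L L' := IsScalarTower.of_algebraMap_eq fun _ => rfl
  haveI : Algebra.EssFiniteType k L := IntermediateField.fg_top_iff.mp hFG
  haveI : Algebra.EssFiniteType L L' := inferInstance
  haveI : Algebra.EssFiniteType k L' := Algebra.EssFiniteType.comp k L L'
  exact divisibleElementsTrivial_points_of_essFiniteType
    (fun E _ _ hE B => hk.abelianVariety E hE B) L' A

/-- Hence every field finitely generated over a SUB-`p`-ADIC field is Kummer-faithful (Rmk. 1.5.4 (i)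
with (ii); equivalently: such a field is again sub-`p`-adic) — recorded for convenience at universe `0`.
[cite: MochizukiAbsTopIII2015, Rmk 1.5.4 (i)–(ii) pp.33–34] -/
theorem isKummerFaithful_of_fg_of_isSubpadic {k L : Type} [Field k] [Field L] [Algebra k L]
    (hFG : (⊤ : IntermediateField k L).FG) (hk : IsSubpadic k) : IsKummerFaithful L :=
  IsKummerFaithful.of_fg hFG (Rmk_1_5_4_i_holds k hk)

end Literature.AnabelianGeometry.AbsoluteAnabelian.AbsTopIII

end
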